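import Summits.AtomisticToContinuum.Crystallization.Theorems.ChartedZeroExcessLayeredLatticeLiouvilleZZV

/-!
# Charted zero-excess layered lattices — Part ZZW: rider R2-C «READ COVERAGE» proved

Route `ChartedPlanarOrder`, station L2′, lineage `stmt-AtomisticToContinuum-26636`; sequel of Parts ZZU (the (B′.5) skeleton) and
ZZV (rider R2-S).  This part DISCHARGES the rider `ReadCovered S K D Ψ Φ ε` of the skeleton from:

* the target chart `IsBarlowBondChart C D Φ τ` (only `MapsTo` and the bond law on `D` are used);
* ★ `hpatch` — LINK CLOSURE of the chart domain `D` within `43/2` of the container (a REQUIREMENT on the LEMMA-C interface,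
  critic row 1494 (c): the charted zone must reach `43/2 + 28/25`; with a global chart `D = univ` it is vacuous);
* ★ `hin` — REG-in of the cool shadow crystal VERBATIM at `(rI, ℓ) = (10, 43/2)`: every target atom `c` with
  `10 < d(c, k)` for all `k ∈ K` and `d(c, k) < 43/2` for some `k ∈ K` has an atom of `S` within `ε`;
* `hsurjΨ` (the S-chart is onto `S`), `K.Nonempty`, `ε ≤ 1/40`, and local finiteness of the charted target sites within `43/2` of `K`.

## Proof (the C-side twin of Part ZZV's walk)

For `y ∈ D` within `27/2` of `K` and the sheet `m ∈ {y.1, y.1 − 1}` start at `z₀ = y`, resp. the site straight below `y` (in `D`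
by `hpatch`), and walk the in-sheet ray `rayPt z₀ t`.  EXIT EVENT `E t`: the ray has left `D` or the potential
`infDist (Φ (rayPt z₀ t)) K` exceeds `203/20 = 81/8 + 1/40`.  It happens (else the infinite injective ray sits in the finite charted
ball), and at its FIRST time `t₀` the site is still in `D` (its predecessor was within `43/2`, `hpatch`) with potential in
`(203/20, max (27/2 + 28/25) (203/20 + 28/25)] ⊂ (81/8 + ε, 155/8 − ε)`.  REG-in gives an S-atom `Ψ z` within `ε` of that target atom,
and `z` lies in the mid window `W = window S K Ψ (81/8) (155/8)` by the triangle inequality.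

0 sorry; standard axioms; no decide; no definitions.
-/

noncomputable section
open Summit.AtomisticToContinuum.Crystallization.Theorems.ChartedPlanarOrderRigidityDoor (E3)

namespace Summit.AtomisticToContinuum.Crystallization.Theorems.ChartedZeroExcessLayeredLatticeLiouville

/-! ### ZZW-1  The exit site of an in-sheet ray inside a link-closed chart domain -/

/-- ★ EXIT LEMMA.  In a chart domain `D` that is link-closed within `43/2` of `K`, the in-sheet ray from `z₀ ∈ D` (potential
`≤ B < 43/2` at the start) reaches, INSIDE `D`, a site whose potential `infDist (Φ ·) K` lies in `(θ, B]`, provided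
`θ + 28/25 ≤ B` (one bond of overshoot) and the charted sites within `43/2` of `K` are finitely many. -/
theorem exists_exit_site {C K : Set E3} {D : Set (ℤ × ℤ × ℤ)} {Φ : ℤ × ℤ × ℤ → E3} {τ : ℤ → Bool}
    (hΦ : IsBarlowBondChart C D Φ τ) (hKne : K.Nonempty)
    (hpatch : ∀ y ∈ D, (∃ k ∈ K, dist (Φ y) k < 43 / 2) → ∀ y' : ℤ × ℤ × ℤ, BarlowAdj τ y y' → y' ∈ D)
    (hfinC : Set.Finite {y : ℤ × ℤ × ℤ | y ∈ D ∧ ∃ k ∈ K, dist (Φ y) k ≤ 43 / 2})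
    {z₀ : ℤ × ℤ × ℤ} (hz₀ : z₀ ∈ D) {θ B : ℝ} (hθB : θ + 28 / 25 ≤ B) (hB : B < 43 / 2)
    (hstart : Metric.infDist (Φ z₀) K ≤ B) :
    ∃ t, rayPt z₀ t ∈ D ∧ θ < Metric.infDist (Φ (rayPt z₀ t)) K ∧ Metric.infDist (Φ (rayPt z₀ t)) K ≤ B := by
  classical
  -- the exit event happens
  have hex : ∃ t, rayPt z₀ t ∉ D ∨ θ < Metric.infDist (Φ (rayPt z₀ t)) K := by
    by_contra hcon
    push Not at hcon
    have hsub : Set.range (rayPt z₀) ⊆ {y : ℤ × ℤ × ℤ | y ∈ D ∧ ∃ k ∈ K, dist (Φ y) k ≤ 43 / 2} := by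
      rintro _ ⟨t, rfl⟩
      obtain ⟨hD, hle⟩ := hcon t
      obtain ⟨k, hk, hd⟩ := (Metric.infDist_lt_iff hKne).1
        (show Metric.infDist (Φ (rayPt z₀ t)) K < 43 / 2 by linarith)
      exact ⟨hD, k, hk, hd.le⟩
    exact Set.infinite_range_of_injective (rayPt_injective z₀) (hfinC.subset hsub)
  -- its first time
  obtain ⟨t₀, ht₀, hmin⟩ : ∃ t₀, (rayPt z₀ t₀ ∉ D ∨ θ < Metric.infDist (Φ (rayPt z₀ t₀)) K) ∧
      ∀ t < t₀, ¬ (rayPt z₀ t ∉ D ∨ θ < Metric.infDist (Φ (rayPt z₀ t)) K) :=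
    ⟨Nat.find hex, Nat.find_spec hex, fun t ht => Nat.find_min hex ht⟩
  have hbefore : ∀ t < t₀, rayPt z₀ t ∈ D ∧ Metric.infDist (Φ (rayPt z₀ t)) K ≤ θ := fun t ht => by
    have h := hmin t ht
    push Not at h
    exact h
  rcases Nat.eq_zero_or_pos t₀ with h0 | hpos
  · -- exit at the start: `z₀ ∈ D`, so the potential already exceeds `θ`
    subst h0
    rw [rayPt_zero] at ht₀
    refine ⟨0, ?_, ?_, ?_⟩ <;> rw [rayPt_zero]
    exacts [hz₀, ht₀.resolve_left (not_not.2 hz₀), hstart]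
  · obtain ⟨s, rfl⟩ : ∃ s, t₀ = s + 1 := ⟨t₀ - 1, by omega⟩
    obtain ⟨hsD, hsθ⟩ := hbefore s (by omega)
    obtain ⟨k, hk, hd⟩ := (Metric.infDist_lt_iff hKne).1
      (show Metric.infDist (Φ (rayPt z₀ s)) K < 43 / 2 by linarith)
    have hD : rayPt z₀ (s + 1) ∈ D := hpatch _ hsD ⟨k, hk, hd⟩ _ (barlowAdj_rayPt τ z₀ s)
    have hb : dist (Φ (rayPt z₀ (s + 1))) (Φ (rayPt z₀ s)) ≤ 28 / 25 := by
      rw [dist_comm]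
      exact ((hΦ.2.2 _ hsD _ hD).2 (barlowAdj_rayPt τ z₀ s)).2
    have htri := Metric.infDist_le_infDist_add_dist (s := K) (x := Φ (rayPt z₀ (s + 1))) (y := Φ (rayPt z₀ s))
    exact ⟨s + 1, hD, ht₀.resolve_left (not_not.2 hD), by linarith⟩

/-! ### ZZW-2  ★ The rider -/

/-- ★ RIDER R2-C «READ COVERAGE» from the target chart, its link closure within `43/2` of `K`, REG-in at `(10, 43/2)`, the
surjectivity of the S-chart, `K ≠ ∅`, `ε ≤ 1/40` and local finiteness on the target side. -/
theorem readCovered {S C K : Set E3} {D : Set (ℤ × ℤ × ℤ)} {Ψ Φ : ℤ × ℤ × ℤ → E3} {τ : ℤ → Bool} {ε : ℝ}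
    (hΦ : IsBarlowBondChart C D Φ τ)
    (hpatch : ∀ y ∈ D, (∃ k ∈ K, dist (Φ y) k < 43 / 2) → ∀ y' : ℤ × ℤ × ℤ, BarlowAdj τ y y' → y' ∈ D)
    (hin : ∀ c ∈ C, (∃ k ∈ K, dist c k < 43 / 2) → (∀ k ∈ K, 10 < dist c k) → ∃ p ∈ S, dist p c ≤ ε)
    (hsurjΨ : ∀ p ∈ S, ∃ x, Ψ x = p) (hKne : K.Nonempty)
    (hfinC : Set.Finite {y : ℤ × ℤ × ℤ | y ∈ D ∧ ∃ k ∈ K, dist (Φ y) k ≤ 43 / 2}) (hε : ε ≤ 1 / 40) :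
    ReadCovered S K D Ψ Φ ε := by
  intro y hy hyK m hm
  obtain ⟨k₀, hk₀, hyk₀⟩ := hyK
  -- the start site on the sheet `m`
  obtain ⟨z₀, hz₀D, hz₀1, hz₀k⟩ : ∃ z₀ ∈ D, z₀.1 = m ∧ dist (Φ z₀) k₀ ≤ 27 / 2 + 28 / 25 := by
    rcases hm with rfl | rfl
    · exact ⟨y, hy, rfl, by linarith⟩
    · have hdown : (y.1 - 1, y.2) ∈ D := hpatch y hy ⟨k₀, hk₀, by linarith⟩ _ (barlowAdj_down τ y)
      refine ⟨(y.1 - 1, y.2), hdown, rfl, ?_⟩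
      have hb := ((hΦ.2.2 y hy _ hdown).2 (barlowAdj_down τ y)).2
      linarith [dist_triangle (Φ (y.1 - 1, y.2)) (Φ y) k₀, dist_comm (Φ y) (Φ (y.1 - 1, y.2))]
  -- walk to the exit site
  obtain ⟨t, htD, hθ, hB⟩ := exists_exit_site hΦ hKne hpatch hfinC hz₀D (θ := 203 / 20) (B := 27 / 2 + 28 / 25)
    (by norm_num) (by norm_num) ((Metric.infDist_le_dist_of_mem hk₀).trans hz₀k)
  -- REG-in at the exit site, and the S-chart site of the registered atom
  have hcC : Φ (rayPt z₀ t) ∈ C := hΦ.2.1 htD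
  obtain ⟨k₁, hk₁, hck₁⟩ := (Metric.infDist_lt_iff hKne).1
    (show Metric.infDist (Φ (rayPt z₀ t)) K < 155 / 8 - 1 / 40 by linarith)
  obtain ⟨p, hpS, hpc⟩ := hin _ hcC ⟨k₁, hk₁, by linarith⟩ (fun k hk => by
    have := Metric.infDist_le_dist_of_mem (x := Φ (rayPt z₀ t)) hk
    linarith)
  obtain ⟨z, rfl⟩ := hsurjΨ p hpS
  refine ⟨z, ⟨hpS, ⟨k₁, hk₁, ?_⟩, fun k hk => ?_⟩, rayPt z₀ t, htD, hpc, Or.inl (by rw [rayPt_fst, hz₀1])⟩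
  · linarith [dist_triangle (Ψ z) (Φ (rayPt z₀ t)) k₁]
  · have := Metric.infDist_le_dist_of_mem (x := Φ (rayPt z₀ t)) hk
    linarith [dist_triangle (Φ (rayPt z₀ t)) (Ψ z) k, dist_comm (Φ (rayPt z₀ t)) (Ψ z)]

end Summit.AtomisticToContinuum.Crystallization.Theorems.ChartedZeroExcessLayeredLatticeLiouville

end
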